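import Mathlib
import Summits.NavierStokesRegularity.NavierStokesRegularity.Theorems.TypeIQuarterGateScarEnvelopeTypeISatelliteTowerGalleryNormalForm
import Summits.NavierStokesRegularity.NavierStokesRegularity.Theorems.TypeIQuarterGateScarEnvelopeTypeISatelliteTowerGalleryResidual
import Summits.NavierStokesRegularity.NavierStokesRegularity.Theorems.TypeIQuarterGateScarEnvelopeTypeISatelliteTowerGallerySaturation

/-!
# TypeIQuarterGate · crux `ScarEnvelopeTypeI` (stmt-NavierStokesRegularity-23843, H3) — ZOOM RECURRENCE: the STRONG
# self-descending normal form and the by-name reduction of 23843 from (E1⁺) ∧ H₂^strong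

LANDING (director-ns #258 = KEY-NS #153 (h)(ii)): the crux workfile `Cruxes/ScarEnvelopeTypeI/ZoomRecurrenceSketch.lean` v3
(author ns-idea-17, crux-write commit cae99fd883e7) landed BY NAME into `Theorems/`, text VERBATIM (namespace
`…Cruxes.ScarEnvelopeTypeI.ZoomDictionary.ZoomRecurrence`, import-only over the lineage's Gallery* modules).  Filed
`--supports stmt-NavierStokesRegularity-23843 --as helper` by an idle prover hand (seat ns-ffc-k1 g7) for the LEAD-23843 lineage.
Reductions / normal forms only — NOT the crux; Navier–Stokes regularity is NOT proved.  Original header follows.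

# Zoom recurrence — sketch v3 (crux idea `zoom-recurrence`, ns-idea-17 g0 → g2, lens «control»,
# crux `TypeIQuarterGate.ScarEnvelopeTypeI` = item 23843)

v3 pays the critic's prices (ns-wall-crit-1 V1 16:50Z P1/P3/P4; V3 17:26Z PRICE (ii)) and follows
the LEAD lineage's advice (ns-sz-p1 g6 FINAL 17:43Z: «IMPORT, do not re-type»).

HONEST FRAMING (P3).  NORMAL FORM / REDUCTION on the H3 wall, movement 0.  Nothing open is proved:
23843, (E1⁺) `∀ M A, ¬ EnvelopedLeaf M A`, the self-descending exclusions H₂ / H₂^strong below,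
the route and Navier–Stokes regularity are OPEN.  NS regularity is NOT proved.

THE CARD'S RUNGS ARE NOW TREE THEOREMS (ns-sz-p1 g6, `--supports 23843 --as helper`; v2's re-typed
`CylConv`/`GalleryLimit`/`RootOmegaLimit` — refutable as typed for want of an `L³_loc` clause, see
`GALLERY-TOOLING-sz-p1-g6.md` — are WITHDRAWN in favour of the tree's `IsGalleryLimit` /
`IsRootOmegaLimit`, which carry `L3loc`):
* (L1) `GalleryTrans`        = `IsGalleryLimit.trans`                      (p650467, …GalleryTransitive)
* (L2) `GalleryClosedAB`     = `abTower_galleryCompact`, `abTower_of_isGalleryLimit₂` (p648930 / p650467)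
* (L9) `GalleryMinRateAttained` = `ABTower.exists_galleryMinimiser`        (p651037, …GalleryMinRate)
* (L12) `OmegaOfMinimiserGlobal` = `ABTower.exists_galleryExactMinimiser`, `ExactPhase.of_isRootOmegaLimit` (p651499 / p653486)
* (L11) `ExistsDoublyMinimal` = `ABTower.exists_rootRecurrent_exactMinimiser`, `exists_minimal_set` (p652533 / p652971)
* (L10) `SaturatedDescent`   = `galleryMinimiser_rootDescends_saturated`   (p653800, …GallerySaturation)
* (L7) `FixedPointNormalForm` = `fixedPointNormalForm`, ★★ `ABTower.envelopedLeaf_or_selfDescending` (p653175, …GalleryNormalForm)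
* glue  `scarEnvelopeTypeI_of_noSelfDescending` = ★★★ `scarEnvelopeTypeI_of_noEnvelopedLeaf_noSelfDescending` (p653175)
* DSS face ⊆ residual: `dss_selfDescendingNode`, `no_dss_sphereScar_of_noSelfDescending`   (p653486, …GalleryResidual)
What this file adds (P1 + PRICE (ii)): the STRONG self-descending node typed INTRINSICALLY over
tree definitions, the proof that under (E1⁺) the weak and strong exclusions are EQUIVALENT (so the
prover of H₂ may assume root-recurrence, exact global equi-rating and own-gallery minimality for
free), the strong fixed-point normal form, and the by-name reduction of 23843 from (E1⁺) ∧ H₂^strong.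
(L8) `NearOneReturnGap` stays an OPEN rung (≈ 300 lines off `AxisActivity.nearOneRateDss_proof`;
structure only, not a kill) and is not re-typed here.

SINGLE ENEMY NAMED: a ROOT-RECURRENT, EXACTLY EQUI-RATED, OWN-GALLERY-MINIMAL SELF-DESCENDING
Albritton–Barker object (field = tangent flow of itself at its own root, sphere satellite at 1/4);
it contains the λ-DSS-with-sphere-scar face (`dss_selfDescendingNode`) = the open Type-I DSS
Liouville problem; the companion card `isolation-radius` (g2) cuts it further to PERFECT scar sets.
-/

noncomputable section

-- the summit-side namespace repeats a component by design (single-conjunct summit, D-0017)  (P4)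
set_option linter.dupNamespace false

open MeasureTheory Set Metric Filter Topology
open scoped ENNReal

namespace Summit.NavierStokesRegularity.NavierStokesRegularity.Cruxes.ScarEnvelopeTypeI.ZoomDictionary

namespace ZoomRecurrence

open Literature.Analysis.FluidPDE

variable {U : ℝ → (EuclideanSpace ℝ (Fin 3)) → (EuclideanSpace ℝ (Fin 3))}
  {P : ℝ → (EuclideanSpace ℝ (Fin 3)) → ℝ}
  {H : ℝ → (EuclideanSpace ℝ (Fin 3)) → (EuclideanSpace ℝ (Fin 3)) →L[ℝ] (EuclideanSpace ℝ (Fin 3))}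
  {M : ℝ}

/-! ### P1 — the STRONG normal form, typed over tree definitions -/

/-- **STRONG SELF-DESCENDING NODE of rate `M`** (intrinsic): a rooted, non-tame, self-descending node
`n` which is ROOT-RECURRENT (`IsRootOmegaLimit n.U n.U`: the field is an `L³_loc` limit of its own
root zooms along a null sequence) and an EXACT, GLOBALLY EQUI-RATED GALLERY MINIMISER IN ITS OWN
GALLERY: `n.U ∈ ABTower m⋆`, every scar of `n.U` has tight rate exactly `m⋆`, and `m⋆ ≤` the tight
rate of every scar of every rate-`M` gallery limit of `n.U`. -/
def StrongSelfDescendingNode (M : ℝ) : Prop :=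
  ∃ n : TNode, RootObj M n ∧ ¬ TameRoot n ∧ RootDescends n n ∧ IsRootOmegaLimit n.U n.U ∧
    ∃ mstar : ℝ, ABTower mstar n.U n.P n.H ∧
      (∀ y : EuclideanSpace ℝ (Fin 3), ¬ RegPt n.U y → tightRate n.U y = mstar) ∧
      ∀ (W₂ : ℝ → (EuclideanSpace ℝ (Fin 3)) → (EuclideanSpace ℝ (Fin 3)))
        (P₂ : ℝ → (EuclideanSpace ℝ (Fin 3)) → ℝ)
        (H₂ : ℝ → (EuclideanSpace ℝ (Fin 3)) → (EuclideanSpace ℝ (Fin 3)) →L[ℝ] (EuclideanSpace ℝ (Fin 3)))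
        (y₂ : EuclideanSpace ℝ (Fin 3)),
        ABTower M W₂ P₂ H₂ → IsGalleryLimit n.U W₂ → ¬ RegPt W₂ y₂ → mstar ≤ tightRate W₂ y₂

/-- ★ Every ROOTED A–B object of rate `M` yields an enveloped leaf of rate `M` or a STRONG
self-descending node of rate `M` (the tree's `ABTower.envelopedLeaf_or_selfDescending` with the
gallery-minimality transported from the parent `U` to the node's own gallery by `IsGalleryLimit.trans`). -/
theorem envelopedLeaf_or_strongSelfDescending (hU : ABTower M U P H) (h0 : ¬ RegPt U 0) :
    (∃ A : ℝ, EnvelopedLeaf M A) ∨ StrongSelfDescendingNode M := by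
  rcases hU.envelopedLeaf_or_selfDescending h0 with
    hE | ⟨n, hn, ht, hd, hg, -, hω, m, hm, -, hsc, hmin⟩
  · exact Or.inl hE
  · have hUmeas : ∀ R : ℝ, 0 < R → AEStronglyMeasurable (Function.uncurry U)
        (volume.restrict (parabolicCylinder R (0 : ℝ × (EuclideanSpace ℝ (Fin 3))))) :=
      fun R hR => hU.aestronglyMeasurable_uncurry hR
    exact Or.inr ⟨n, hn, ht, hd, hω, m, hm, hsc,
      fun W₂ P₂ H₂ y₂ h₂ hg₂ hy₂ => hmin W₂ P₂ H₂ y₂ h₂ (hg.trans hUmeas hg₂) hy₂⟩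

/-- **(L7) strong**: an infinite root descent forces an enveloped leaf or a STRONG self-descending node. -/
theorem fixedPointNormalFormStrong (M : ℝ) (h : InfiniteRootDescent M) :
    (∃ A : ℝ, EnvelopedLeaf M A) ∨ StrongSelfDescendingNode M := by
  obtain ⟨c, hc⟩ := h
  obtain ⟨⟨hAB, h0⟩, -, -⟩ := hc 0
  exact envelopedLeaf_or_strongSelfDescending hAB h0

/-- ★ **Under (E1⁺) the weak and the strong self-descending exclusions are EQUIVALENT** — the
honest booking of the transfer (PRICE P3): `C⁺ := (E1⁺) ∧ ∀ M, ¬ StrongSelfDescendingNode M` is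
equivalent to the tree's pair `(E1⁺) ∧ H₂`; the gain is structure handed to the prover, not strength. -/
theorem noSelfDescending_iff_noStrong_of_noEnvelopedLeaf (hE : ∀ M A : ℝ, ¬ EnvelopedLeaf M A) :
    (∀ (M : ℝ) (n : TNode), RootObj M n → ¬ TameRoot n → ¬ RootDescends n n) ↔
    ∀ M : ℝ, ¬ StrongSelfDescendingNode M := by
  constructor
  · rintro h M ⟨n, hn, ht, hd, -⟩
    exact h M n hn ht hd
  · intro h M n hn ht _
    rcases envelopedLeaf_or_strongSelfDescending hn.1 hn.2 with ⟨A, hA⟩ | hs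
    · exact (hE M A hA).elim
    · exact (h M hs).elim

/-- ★★ **By-name reduction of 23843 from (E1⁺) and the STRONG exclusion** (PRICE (ii): the card's
glue re-pointed to the tree's `scarEnvelopeTypeI_of_noEnvelopedLeaf_noSelfDescending`). -/
theorem scarEnvelopeTypeI_of_noEnvelopedLeaf_noStrongSelfDescending
    (hE : ∀ M A : ℝ, ¬ EnvelopedLeaf M A) (hS : ∀ M : ℝ, ¬ StrongSelfDescendingNode M) :
    Summit.NavierStokesRegularity.NavierStokesRegularity.Theses.TypeIQuarterGate.ScarEnvelopeTypeI :=
  scarEnvelopeTypeI_of_noEnvelopedLeaf_noSelfDescending hE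
    ((noSelfDescending_iff_noStrong_of_noEnvelopedLeaf hE).2 hS)

/-- The same from the route's literal first exclusion (E1) `∀ M, ¬ OneScarLeaf M`. -/
theorem scarEnvelopeTypeI_of_noOneScarLeaf_noStrongSelfDescending
    (hE : ∀ M : ℝ, ¬ OneScarLeaf M) (hS : ∀ M : ℝ, ¬ StrongSelfDescendingNode M) :
    Summit.NavierStokesRegularity.NavierStokesRegularity.Theses.TypeIQuarterGate.ScarEnvelopeTypeI :=
  scarEnvelopeTypeI_of_noEnvelopedLeaf_noStrongSelfDescending (noEnvelopedLeaf_of_noOneScarLeaf hE) hS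

/-! ### The DSS face of the strong residual (tree, p653486) -/

/-- Under (E1⁺), a rooted λ-DSS A–B object with a scar on the sphere `‖z‖ = 1/4` yields a STRONG
self-descending node of the same rate (so H₂^strong still contains the open Type-I DSS Liouville
face; the residual is honest, not smaller than the wall). -/
theorem strongSelfDescending_of_dss_sphereScar (hE : ∀ M A : ℝ, ¬ EnvelopedLeaf M A)
    {W : ℝ → (EuclideanSpace ℝ (Fin 3)) → (EuclideanSpace ℝ (Fin 3))} (h : ABTower M W P H)
    (h0 : ¬ RegPt W 0) {lam : ℝ} (hlam0 : 0 < lam) (hlam1 : lam < 1) (hdss : zoom W 0 0 lam = W)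
    {z : EuclideanSpace ℝ (Fin 3)} (hz : ‖z‖ = 1 / 4) (hzs : ¬ RegPt W z) :
    StrongSelfDescendingNode M := by
  obtain ⟨hn, -, -⟩ := dss_selfDescendingNode h h0 hlam0 hlam1 hdss hz hzs
  rcases envelopedLeaf_or_strongSelfDescending hn.1 hn.2 with ⟨A, hA⟩ | hs
  · exact (hE M A hA).elim
  · exact hs

end ZoomRecurrence

end Summit.NavierStokesRegularity.NavierStokesRegularity.Cruxes.ScarEnvelopeTypeI.ZoomDictionary
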